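import Mathlib
import Summits.Ventures.Crystal3D.Theorems.StickyWulffConstantTextureLiminfTentBilayerTables
import Summits.Ventures.Crystal3D.Theorems.StickyWulffConstantTextureLiminfTentMass
import Summits.Ventures.Crystal3D.Theorems.StickyWulffConstantTextureLiminfTexShadowDefs
import Literature.Analysis.Convexity.AnisotropicPerimeterPolytopePrism
import Literature.Analysis.Convexity.AnisotropicPerimeterComplement
import Literature.Analysis.Convexity.FinitePerimeterTransform
import Literature.MathematicalPhysics.StatisticalMechanics.FccWulffBodyHull
import HarnessLib

/-!
# The tent certificate — one bilayer slab: prelude (eng g9)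

Route `StickyWulffConstant` (`Summits/Ventures/Crystal3D`, cell `crystal3d-full`), support toward the crux
`TextureLiminf` (stmt-Ventures-19483), line TexShadow v6.2, stub `stub_barlowFreeCertificate` (the Barlow
tent).  Small facts used by the bilayer certificate `…TentBilayerCertificate.lean`:
* `hasFinitePerimeter_polytope` — a bounded open polytope with unit normals and pairwise distinct facet planes
  has finite perimeter (its perimeter is the finite facet sum of
  `Literature/…/AnisotropicPerimeterPolytopePrism.lean`);
* `setIntegral_fieldDivergence_inter_eq` — the divergence of a field supported in `V` integrates over `A ∩ V`
  as over `A` (continuity / compact support of the divergence, and `div = 0` off the support);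
* `tent_eq_one_of_forall_lay` — SLAB-LOCAL MASS LEMMA: a point of the open bilayer slab
  `{0 < ⟪(1,1,1), √2 y⟫ < 2}` all of whose sites OF THE TWO LAYERS `0, 1` within `√2` are occupied has
  `f_X = 1` (the closed chamber containing it has `m₀ = 0`, so its vertices lie in those two layers).
WHAT THIS IS NOT: the certificate; F-C1 not moved.
-/

noncomputable section

namespace Summit.Ventures.Crystal3D.TentCertificate

open Finset Summit.Ventures.Crystal3D MeasureTheory Literature.Analysis.Convexity
open Literature.Geometry.DiscreteGeometry (intVec intVec_apply)
open Literature.MathematicalPhysics.StatisticalMechanics (phiFcc phiFcc_nonneg phiFcc_neg fccWulffBody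
  isGreatest_inner_fccWulffBody fieldDivergence HasFinitePerimeter zero_mem_fccWulffBody isCompact_fccWulffBody)
open Summit.Ventures.Crystal3D.Cruxes.TextureLiminf.TexShadow (polytope)
open scoped RealInnerProductSpace ENNReal

/-! ## Finite perimeter of a polytope piece -/

/-- A polytope is open, hence measurable. -/
theorem measurableSet_polytope (H : Finset (EuclideanSpace ℝ (Fin 3) × ℝ)) : MeasurableSet (polytope H) := by
  unfold polytope
  exact (isOpen_biInter_finset fun _ _ =>
    isOpen_lt (continuous_const.inner continuous_id) continuous_const).measurableSet

/-- **A bounded open polytope with unit normals and pairwise distinct facet planes has finite perimeter**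
(its perimeter is the finite facet sum). -/
theorem hasFinitePerimeter_polytope (H : Finset (EuclideanSpace ℝ (Fin 3) × ℝ))
    (hbd : Bornology.IsBounded (polytope H)) (h1 : ∀ p ∈ H, ‖p.1‖ = 1)
    (hd : ∀ p ∈ H, ∀ p' ∈ H, p ≠ p' → {x : EuclideanSpace ℝ (Fin 3) | ⟪p.1, x⟫ = p.2} ≠ {x | ⟪p'.1, x⟫ = p'.2}) :
    HasFinitePerimeter (polytope H) := by
  refine ⟨measurableSet_polytope H, ?_⟩
  rw [perimeter_eq_anisotropicPerimeter_closedBall]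
  unfold polytope at hbd ⊢
  rw [anisotropicPerimeter_iInter_halfSpace_lt_eq_facetSum H hbd h1 hd (isCompact_closedBall 0 1)
    (convex_closedBall 0 1) (Metric.mem_closedBall_self zero_le_one)]
  exact ENNReal.ofReal_lt_top

/-! ## Integrability of a divergence -/

/-- The divergence of a `C¹` field is continuous (trace of the continuous derivative). -/
theorem continuous_fieldDivergence' {φ : EuclideanSpace ℝ (Fin 3) → EuclideanSpace ℝ (Fin 3)}
    (hφ : ContDiff ℝ 1 φ) : Continuous (fieldDivergence φ) := by
  have h1 : Continuous (fderiv ℝ φ) := hφ.continuous_fderiv one_ne_zero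
  let T : (EuclideanSpace ℝ (Fin 3) →L[ℝ] EuclideanSpace ℝ (Fin 3)) →ₗ[ℝ] ℝ :=
    (LinearMap.trace ℝ (EuclideanSpace ℝ (Fin 3))).comp (ContinuousLinearMap.coeLM ℝ)
  have hT : Continuous T := T.continuous_of_finiteDimensional
  exact hT.comp h1

/-- The divergence of a compactly supported `C¹` field has compact support. -/
theorem hasCompactSupport_fieldDivergence' {φ : EuclideanSpace ℝ (Fin 3) → EuclideanSpace ℝ (Fin 3)}
    (hc : HasCompactSupport φ) : HasCompactSupport (fieldDivergence φ) := by
  have h : fieldDivergence φ = (fun A : EuclideanSpace ℝ (Fin 3) →L[ℝ] EuclideanSpace ℝ (Fin 3) =>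
      LinearMap.trace ℝ (EuclideanSpace ℝ (Fin 3)) (A : EuclideanSpace ℝ (Fin 3) →ₗ[ℝ] EuclideanSpace ℝ (Fin 3))) ∘
      fderiv ℝ φ := rfl
  rw [h]
  exact (hc.fderiv ℝ).comp_left (by simp)

/-- **Localisation of a divergence integral**: if the field is supported in `V`, the integral of its
divergence over `A ∩ V` equals the one over `A`. -/
theorem setIntegral_fieldDivergence_inter_eq {φ : EuclideanSpace ℝ (Fin 3) → EuclideanSpace ℝ (Fin 3)}
    (hφ : ContDiff ℝ 1 φ) (hc : HasCompactSupport φ) {A V : Set (EuclideanSpace ℝ (Fin 3))}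
    (hV : MeasurableSet V) (hsupp : tsupport φ ⊆ V) :
    ∫ z in A ∩ V, fieldDivergence φ z = ∫ z in A, fieldDivergence φ z := by
  have hint : Integrable (fieldDivergence φ) :=
    (continuous_fieldDivergence' hφ).integrable_of_hasCompactSupport (hasCompactSupport_fieldDivergence' hc)
  have h := integral_inter_add_sdiff hV (hint.integrableOn : IntegrableOn (fieldDivergence φ) A volume)
  have h0 : ∫ z in A \ V, fieldDivergence φ z = 0 :=
    setIntegral_eq_zero_of_forall_eq_zero fun z hz =>
      fieldDivergence_eq_zero_of_notMem_tsupport fun h' => hz.2 (hsupp h')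
  rw [h0, add_zero] at h
  exact h

/-! ## The bilayer slab and the slab-local mass clause -/

/-- A closed chamber meeting the open slab `{0 < s < 2}` (`s = ⟪(1,1,1), √2 x⟫`) has `m₀ = 0`. -/
theorem label_zero_of_mem_closedChamber_of_slab {k : Fin 3 → ℤ} {m : Fin 4 → ℤ} {y : EuclideanSpace ℝ (Fin 3)}
    (hy : y ∈ closedChamber k m) (h0 : 0 < ⟪intVec (normal4 0), Real.sqrt 2 • y⟫)
    (h2 : ⟪intVec (normal4 0), Real.sqrt 2 • y⟫ < 2) : m 0 = 0 := by
  have hc := hy.2 0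
  have h1 : (m 0 : ℝ) < 1 := by linarith [hc.1]
  have h2' : (-1 : ℝ) < m 0 := by linarith [hc.2]
  have h1' : m 0 < 1 := by exact_mod_cast h1
  have h2'' : -1 < m 0 := by exact_mod_cast h2'
  omega

/-- **Slab-local mass lemma**: if `y` lies in the open bilayer slab `{0 < ⟪(1,1,1), √2 y⟫ < 2}` and every site
OF THE LAYERS `0, 1` within `√2` of `y` is occupied, the tent equals `1` at `y`. -/
theorem tent_eq_one_of_forall_lay (X : Finset Site) {y : EuclideanSpace ℝ (Fin 3)}
    (h0 : 0 < ⟪intVec (normal4 0), Real.sqrt 2 • y⟫) (h2 : ⟪intVec (normal4 0), Real.sqrt 2 • y⟫ < 2)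
    (hy : ∀ a : Site, (lay a = 0 ∨ lay a = 1) → dist (site a) y ≤ Real.sqrt 2 → a ∈ X) : tent X y = 1 := by
  obtain ⟨p, κ, hyc⟩ := exists_mem_closedChamber_labelOf y
  have hm0 := label_zero_of_mem_closedChamber_of_slab hyc h0 h2
  obtain ⟨g, b, hgb⟩ := exists_affine_tent X (labelOf p κ).1 (labelOf p κ).2
  rcases κ with bb | s
  · rcases Bool.eq_false_or_eq_true bb with hb | hb <;> subst hb
    · have hyc' : y ∈ closedChamber (labelUp p).1 (labelUp p).2 := by simpa [labelOf] using hyc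
      have hgb' : ∀ x ∈ closedChamber (labelUp p).1 (labelUp p).2, tent X x = ⟪g, x⟫ + b := by
        simpa [labelOf] using hgb
      have hlp : lay p = 0 := by simpa [labelOf, labelUp, lay] using hm0
      have hv : ∀ j : Fin 4, ⟪g, site (p + tetUpV j)⟫ + b = 1 := by
        intro j
        have hmem := site_tetUpV_mem_closedChamber p j
        rw [← hgb' _ hmem, site_eq, tent_site, if_pos (hy _ ?_ ?_)]
        · rw [lay_add, hlp, lay_tetUpV]; by_cases hj : j = 0 <;> simp [hj]
        · exact dist_le_sqrt2_of_mem_closedChamber hmem hyc'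
      obtain ⟨t₀, t₁, t₂, -, -, -, -, hcombo⟩ := affine_eq_combo_labelUp p g b hyc'
      rw [← hgb' y hyc', hv, hv, hv, hv] at hcombo
      rw [hcombo]; ring
    · have hyc' : y ∈ closedChamber (labelDn p).1 (labelDn p).2 := by simpa [labelOf] using hyc
      have hgb' : ∀ x ∈ closedChamber (labelDn p).1 (labelDn p).2, tent X x = ⟪g, x⟫ + b := by
        simpa [labelOf] using hgb
      have hlp : lay p = 1 := by
        have : p 0 + p 1 + p 2 - 1 = 0 := by simpa [labelOf, labelDn] using hm0
        simp only [lay]; omega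
      have hv : ∀ j : Fin 4, ⟪g, site (p + tetDnV j)⟫ + b = 1 := by
        intro j
        have hmem := site_tetDnV_mem_closedChamber p j
        rw [← hgb' _ hmem, site_eq, tent_site, if_pos (hy _ ?_ ?_)]
        · rw [lay_add, hlp, lay_tetDnV]; by_cases hj : j = 0 <;> simp [hj]
        · exact dist_le_sqrt2_of_mem_closedChamber hmem hyc'
      obtain ⟨t₀, t₁, t₂, -, -, -, -, hcombo⟩ := affine_eq_combo_labelDn p g b hyc'
      rw [← hgb' y hyc', hv, hv, hv, hv] at hcombo
      rw [hcombo]; ring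
  · have hyc' : y ∈ closedChamber (labelCorner p s).1 (labelCorner p s).2 := by simpa [labelOf] using hyc
    have hgb' : ∀ x ∈ closedChamber (labelCorner p s).1 (labelCorner p s).2, tent X x = ⟪g, x⟫ + b := by
      simpa [labelOf] using hgb
    have hlp : lay p = 0 := by simpa [labelOf, labelCorner, lay] using hm0
    have hall : ∀ i : Fin 6, p + octV i ∈ X := by
      intro i
      refine hy _ ?_ (dist_octV_le_sqrt2 p s hyc' i)
      rw [lay_add, hlp, lay_octV, zero_add]
      revert i; decide
    have hpat : patO X p = fun _ => true := by funext i; simp [patO, hall i]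
    have hv : ∀ a : Fin 3, ⟪g, site (p + octV (octIdx a (s a)))⟫ + b = 1 := by
      intro a
      rw [← hgb' _ (site_octV_mem_closedChamber p s a), site_eq, tent_site, if_pos (hall _)]
    have hc : ⟪g, centre p⟫ + b = 1 := by
      rw [← hgb' _ (centre_mem_closedChamber p s), tent_centre, hpat, twoAlpha_all_true]; norm_num
    obtain ⟨t₀, t₁, t₂, -, -, -, -, hcombo⟩ := affine_eq_combo_labelCorner p s g b hyc'
    rw [← hgb' y hyc', hc, hv, hv, hv] at hcombo
    rw [hcombo]; ring

end Summit.Ventures.Crystal3D.TentCertificate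

end
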